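import Mathlib.NumberTheory.LSeries.Basic
import Mathlib.Analysis.SpecialFunctions.Pow.Real
import Mathlib.Analysis.SpecialFunctions.Log.Basic
import Mathlib.Analysis.Complex.ExponentialBounds
import Mathlib.Analysis.Real.Pi.Bounds
import HarnessLib

/-!
# Logarithmic mean values `Σ_{n ≤ x} f(n)/n` of totally multiplicative `f`, `|f| ≤ 1` (Montgomery–Vaughan 2001)

Named facts (D-0014) from H. L. Montgomery, R. C. Vaughan, *Mean values of multiplicative functions*,
Period. Math. Hungar. **43** (2001), 199–214: the estimates for

  `S₁(x) = Σ_{n ≤ x} f(n)/n`   in terms of   `F(s) = Σ_{n ≥ 1} f(n) n^{-s}`  (`σ > 1`),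

`f` totally multiplicative with `|f(n)| ≤ 1` — Theorem 3 (p. 201, (4)), with its Lemma 1 and Lemma 2
(pp. 208–210). They are the inputs of Theorem 4 of the paper (p. 202: `U_N(s) = Σ_{n ≤ N} n^{-s} ≠ 0`
for `σ ≥ 1 + (4/π − 1) log log N/log N`, `N > N₀`), vendored as
`Literature.Barriers.RiemannHypothesis.MontgomeryVaughan2001_zeroFree` in
`Literature/Barriers/RiemannHypothesis/TuranPartialSums.lean`; the deduction "Theorem 3 ⇒ Theorem 4"
(§4 of the paper: partial summation of the tail `Σ_{n > N} n^{-s}` with `f(n) = n^{-it}`) is proved in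
`Literature/Barriers/RiemannHypothesis/TuranPartialSumsProofs.lean`.

## Conventions

* "totally multiplicative `f` with `|f(n)| ≤ 1` for all `n`" is `f : ℕ →*₀ ℂ` (so `f 0 = 0`, `f 1 = 1`,
  `f (m n) = f m · f n`) together with `∀ n, ‖f n‖ ≤ 1`; the value at `0` never enters (`S₁` sums over
  `1 ≤ n ≤ x`, and `LSeries` drops the index `0`).
* `F(s)` is Mathlib's `LSeries (f ·) s`; for real `σ > 1` it converges absolutely.
* The implied constants of the paper ("`≪`", uniform in `f`, `x`, `σ`, `t`) are existentially quantified
  absolute constants `C`.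
* Quotients `F(σ₂)/F(σ₁)` are cleared of denominators (`F(σ) ≠ 0` for `σ > 1` by the Euler product, but
  the division-free form is what users need).

## Not vendored here

Theorem 2 (p. 201, (3)): `S₁(x) ≪ (1/log x) ∫_{1/log x}^1 M₁(α) α^{-1} dα` with
`M₁(α) = (Σ_{k ∈ ℤ} max_{|t−k| ≤ 1/2, 1+α ≤ σ ≤ 2} |F(σ+it)/(σ−1+it)|²)^{1/2}` — the Halász-type
theorem from which Theorem 3 is deduced (§3, (23)–(24)); its `M₁` (a `tsum` of suprema over boxes) is
left to the file that proves it. Theorem 1 (Halász–Montgomery–Tenenbaum for `Σ_{n ≤ x} f(n)`) and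
Theorem 5 are not used.

## References

* [MontgomeryVaughan2001] H. L. Montgomery, R. C. Vaughan, *Mean values of multiplicative functions*,
  Period. Math. Hungar. 43 (2001), 199–214, doi:10.1023/a:1015202219630 (read: pp. 199–202, Thms 1–4;
  §3 pp. 208–211, Lemmas 1–2, (23)–(24); §4 pp. 211–212).
-/

noncomputable section

open Complex

namespace Literature.NumberTheory.LFunctions

namespace MontgomeryVaughan2001

/-- `S₁(x) = Σ_{n ≤ x} f(n)/n` (Montgomery–Vaughan 2001, p. 200), for real `x` (empty for `x < 1`).
[cite: MontgomeryVaughan2001, §1 (p. 200)] -/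
def S₁ (f : ℕ → ℂ) (x : ℝ) : ℂ :=
  ∑ n ∈ Finset.Icc 1 ⌊x⌋₊, f n / n

/-- `S₁(x)` at a natural number `N`: `Σ_{n=1}^{N} f(n)/n`. [cite: MontgomeryVaughan2001, §1 (p. 200)] -/
theorem S₁_natCast (f : ℕ → ℂ) (N : ℕ) :
    S₁ f N = ∑ n ∈ Finset.Icc 1 N, f n / n := by
  rw [S₁, Nat.floor_natCast]

/-- The trivial bound `|S₁(x)| ≤ Σ_{n ≤ x} 1/n` when `|f(n)| ≤ 1` ("The trivial upper bound is
`S₁(x) ≪ log x`", p. 201). [cite: MontgomeryVaughan2001, §1 p. 201] -/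
theorem norm_S₁_le (f : ℕ → ℂ) (hf : ∀ n, ‖f n‖ ≤ 1) (x : ℝ) :
    ‖S₁ f x‖ ≤ ∑ n ∈ Finset.Icc 1 ⌊x⌋₊, (1 : ℝ) / n := by
  refine (norm_sum_le _ _).trans (Finset.sum_le_sum fun n hn ↦ ?_)
  rw [Finset.mem_Icc] at hn
  have hn0 : (0 : ℝ) < n := by exact_mod_cast hn.1
  rw [norm_div, Complex.norm_natCast]
  exact div_le_div_of_nonneg_right (hf n) hn0.le

end MontgomeryVaughan2001

open MontgomeryVaughan2001

/-- **Montgomery–Vaughan 2001, Lemma 1** (p. 208). "Suppose that `f(n)` is a totally multiplicative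
function such that `|f(n)| ≤ 1` for all `n`, and for `σ > 1` let `F(s)` be defined as in (1). If
`1 < σ₁ ≤ σ₂ ≤ 2` then `(σ₁ − 1)/(σ₂ − 1) ≪ |F(σ₂)/F(σ₁)| ≪ (σ₂ − 1)/(σ₁ − 1)`." Division-free form
with one absolute constant `C`. (Proof in the source: the quotient is
`≍ exp(Re Σ_p f(p)(p^{-σ₂} − p^{-σ₁}))` and `Σ_p (p^{-σ₁} − p^{-σ₂}) = log(ζ(σ₁)/ζ(σ₂)) + O(1)`.)
[cite: MontgomeryVaughan2001, Lemma 1] -/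
def MontgomeryVaughan2001_lemma1 : Prop :=
  ∃ C : ℝ, 0 < C ∧ ∀ f : ℕ →*₀ ℂ, (∀ n, ‖f n‖ ≤ 1) →
    ∀ σ₁ σ₂ : ℝ, 1 < σ₁ → σ₁ ≤ σ₂ → σ₂ ≤ 2 →
      (σ₁ - 1) * ‖LSeries (f ·) σ₁‖ ≤ C * (σ₂ - 1) * ‖LSeries (f ·) σ₂‖ ∧
      (σ₁ - 1) * ‖LSeries (f ·) σ₂‖ ≤ C * (σ₂ - 1) * ‖LSeries (f ·) σ₁‖

/-- **Montgomery–Vaughan 2001, Lemma 2** (p. 209). "Let `f(n)` and `F(s)` be as in the preceding lemma.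
If `1 < σ ≤ 2` and `|t| ≤ 2` then `F(σ + it)/F(σ) ≪ (1 + |t|/(σ − 1))^{4/π}`. If `1 < σ ≤ 2` and
`|t| ≥ 2` then `F(σ + it)/F(σ) ≪ (log|t|/(σ − 1))^{4/π}`." Division-free, one absolute constant. (Proof
in the source: `|F(σ+it)/F(σ)| ≤ exp(2 Σ_p p^{-σ}|sin(½ t log p)|)`, Mertens' `Σ_{p ≤ y} 1/p =
log log y + c + O(1/log 2y)` with `∫_0^y |sin u| du = (2/π)y + O(1)` for `|t| ≤ 2`, and for `|t| ≥ 2` the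
Fourier series of `|sin πθ|`, `Π_k |ζ(σ − ikt)|^{2c_k}`, and `|ζ(σ+it)| ≥ 1/(C log t)` (`σ ≥ 1`, `t ≥ 2`,
Titchmarsh (3.11.8)).) The exponent `4/π = 2 · (2/π)` is twice the mean value of `|sin|`.
[cite: MontgomeryVaughan2001, Lemma 2] -/
def MontgomeryVaughan2001_lemma2 : Prop :=
  ∃ C : ℝ, 0 < C ∧ ∀ f : ℕ →*₀ ℂ, (∀ n, ‖f n‖ ≤ 1) →
    ∀ σ t : ℝ, 1 < σ → σ ≤ 2 →
      (|t| ≤ 2 → ‖LSeries (f ·) (σ + t * I)‖ ≤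
          C * (1 + |t| / (σ - 1)) ^ (4 / Real.pi) * ‖LSeries (f ·) σ‖) ∧
      (2 ≤ |t| → ‖LSeries (f ·) (σ + t * I)‖ ≤
          C * (Real.log |t| / (σ - 1)) ^ (4 / Real.pi) * ‖LSeries (f ·) σ‖)

/-- **Montgomery–Vaughan 2001, Theorem 3** (p. 201, (4)). "Suppose that `x ≥ 3`, and that
`1 + 1/log x ≤ σ ≤ 2`. If `f(n)` is a totally multiplicative function such that `|f(n)| ≤ 1` for all
`n`, then `S₁(x) ≪ |F(σ)| (σ − 1) ((σ − 1)^{-4/π} + log x)`." The implied constant is absolute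
(uniform in `f`, `x`, `σ`). In particular ((5), `σ = 1 + 1/log x`) `S₁(x) ≪ |F(1 + 1/log x)|
(log x)^{4/π − 1}`, which is sharp. (Deduced in the source from Theorem 2 via Lemmas 1–2 and the box
estimates (23)–(24).) [cite: MontgomeryVaughan2001, Theorem 3] -/
def MontgomeryVaughan2001_thm3 : Prop :=
  ∃ C : ℝ, 0 < C ∧ ∀ f : ℕ →*₀ ℂ, (∀ n, ‖f n‖ ≤ 1) →
    ∀ x : ℝ, 3 ≤ x → ∀ σ : ℝ, 1 + 1 / Real.log x ≤ σ → σ ≤ 2 →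
      ‖S₁ f x‖ ≤ C * ‖LSeries (f ·) σ‖ * (σ - 1) * ((σ - 1) ^ (-(4 / Real.pi)) + Real.log x)

/-- The special case (5) of Theorem 3 at `σ = 1 + 1/log x`:
`|S₁(x)| ≤ 2C |F(1 + 1/log x)| (log x)^{4/π − 1}` for `x ≥ 3` (here `σ − 1 = 1/log x`, so
`(σ − 1)((σ − 1)^{-4/π} + log x) = (log x)^{4/π − 1} + 1 ≤ 2 (log x)^{4/π − 1}` as `log x ≥ 1`).
[cite: MontgomeryVaughan2001, Theorem 3, (5)] -/
theorem MontgomeryVaughan2001_thm3.at_one_add_inv_log (h : MontgomeryVaughan2001_thm3) :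
    ∃ C : ℝ, 0 < C ∧ ∀ f : ℕ →*₀ ℂ, (∀ n, ‖f n‖ ≤ 1) → ∀ x : ℝ, 3 ≤ x →
      ‖S₁ f x‖ ≤ C * ‖LSeries (f ·) (1 + 1 / Real.log x : ℝ)‖ * Real.log x ^ (4 / Real.pi - 1) := by
  obtain ⟨C, hC, hT⟩ := h
  refine ⟨2 * C, by positivity, fun f hf x hx ↦ ?_⟩
  have hlog1 : 1 ≤ Real.log x := by
    rw [Real.le_log_iff_exp_le (by linarith)]
    exact le_trans (by have := Real.exp_one_lt_d9; linarith) hx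
  have hlogpos : 0 < Real.log x := by linarith
  have hσ2 : 1 + 1 / Real.log x ≤ 2 := by
    have : 1 / Real.log x ≤ 1 := by rw [div_le_one hlogpos]; exact hlog1
    linarith
  have key := hT f hf x hx (1 + 1 / Real.log x) le_rfl hσ2
  have hsub : (1 + 1 / Real.log x : ℝ) - 1 = (Real.log x)⁻¹ := by ring
  rw [hsub] at key
  have hpow : (Real.log x)⁻¹ ^ (-(4 / Real.pi)) = Real.log x ^ (4 / Real.pi) := by
    rw [Real.inv_rpow hlogpos.le, ← Real.rpow_neg hlogpos.le, neg_neg]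
  rw [hpow] at key
  have hsplit : Real.log x ^ (4 / Real.pi) = Real.log x ^ (4 / Real.pi - 1) * Real.log x := by
    rw [Real.rpow_sub_one hlogpos.ne']; field_simp
  -- `(log x)⁻¹ ((log x)^{4/π} + log x) = (log x)^{4/π-1} + 1 ≤ 2 (log x)^{4/π-1}`
  have hfac : (Real.log x)⁻¹ * (Real.log x ^ (4 / Real.pi) + Real.log x)
      = Real.log x ^ (4 / Real.pi - 1) + 1 := by
    rw [hsplit]; field_simp
  have hone : (1 : ℝ) ≤ Real.log x ^ (4 / Real.pi - 1) := by
    apply Real.one_le_rpow hlog1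
    rw [sub_nonneg, le_div_iff₀ Real.pi_pos]; linarith [Real.pi_lt_four]
  have hF := norm_nonneg (LSeries (f ·) (1 + 1 / Real.log x : ℝ))
  calc ‖S₁ f x‖ ≤ C * ‖LSeries (f ·) (1 + 1 / Real.log x : ℝ)‖ * (Real.log x)⁻¹ *
        (Real.log x ^ (4 / Real.pi) + Real.log x) := key
    _ = C * ‖LSeries (f ·) (1 + 1 / Real.log x : ℝ)‖ * (Real.log x ^ (4 / Real.pi - 1) + 1) := by
        rw [mul_assoc (C * _), hfac]
    _ ≤ C * ‖LSeries (f ·) (1 + 1 / Real.log x : ℝ)‖ * (2 * Real.log x ^ (4 / Real.pi - 1)) := by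
        apply mul_le_mul_of_nonneg_left _ (by positivity)
        linarith
    _ = 2 * C * ‖LSeries (f ·) (1 + 1 / Real.log x : ℝ)‖ * Real.log x ^ (4 / Real.pi - 1) := by ring

end Literature.NumberTheory.LFunctions
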